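import Summits.AtomisticToContinuum.BoseEinsteinCondensation.Theses.BECStronglyRayleigh
import Summits.AtomisticToContinuum.BoseEinsteinCondensation.Theorems.InsertionFieldDelocalisation.Negative.Toolkit
import Summits.AtomisticToContinuum.BoseEinsteinCondensation.Theorems.InsertionFieldDelocalisation.Negative.LoadBearing
import Summits.AtomisticToContinuum.BoseEinsteinCondensation.Theorems.InsertionFieldDelocalisation.Negative.Tightness
import Summits.AtomisticToContinuum.BoseEinsteinCondensation.Theorems.BECStronglyRayleighSectorGroundStatePerron
import HarnessLib

/-!
# DREFUTE workfile — line `mobile-trap-dirichlet-eigenfunction` (crux stmt-AtomisticToContinuum-9673, K1)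

Refuter seat refuter-drefute-stmt-AtomisticToContinuum-9673-g2-0, 2026-08-16.  Companion of the report
`DREFUTE-mobile-trap-dirichlet-eigenfunction.md` (same directory).  Findings as theorems, all `sorry`-free,
axioms `propext`/`Classical.choice`/`Quot.sound`; the same declarations are proposed for landing as
`Theorems/InsertionFieldDelocalisation/Negative/MobileTrapLoadBearing.lean` (p86805) and
`…/Negative/MobileTrapVoidTail.lean` (p86829) under the `…Theorems.InsertionFieldDelocalisation.Negative`
namespace — import THOSE once accepted; this copy lives under a Cruxes namespace only so that the crux
directory carries the checked content at once.

Stub set attacked (lead's def-free skeleton `Lines/mobile_trap_dirichlet_eigenfunction.lean`, sha 378a27ec8879):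
0 stub-false, 0 stub-misstated, 6 survived.  Load-bearing analysis of the two XL stubs:

* `annealedGain_false_without_groundState` — `AnnealedGain'` minus `Hψ = E_min ψ`: FALSE (frozen pair, `R = 0`).
* `annealedGain_false_without_halfFilling` — `AnnealedGain'` minus `2N ≤ L³`: FALSE (all-up state, `R = 1`).
* `voidTail_false_without_groundState` — `VoidTail'` minus `Hψ = E_min ψ`: FALSE (far-slab cluster, `L = 4N`,
  `R = N`; distance lower bound `torusDepth_le_dist`).
* (no lemma) `VoidTail'` minus `2N ≤ L³` is apparently still true (voids impossible near full filling).

Toolkit on the raw void-radius expression of the stubs: `voidRadius_empty`, `voidRadius_eq_one`,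
`torusDepth_le_dist`, `exists_large_N`.
-/

noncomputable section

namespace Summit.AtomisticToContinuum.BoseEinsteinCondensation.Cruxes.InsertionFieldDelocalisation.DrefuteMobileTrap

open scoped BigOperators ComplexOrder
open Literature.MathematicalPhysics.QuantumLattice Literature.Probability.LatticeModels Matrix Finset
open Summit.AtomisticToContinuum.BoseEinsteinCondensation.Theses.BECStronglyRayleigh
open Summit.AtomisticToContinuum.BoseEinsteinCondensation.Theorems.InsertionFieldDelocalisation.Negative
open Summit.AtomisticToContinuum.BoseEinsteinCondensation.Theorems.BECStronglyRayleighSectorPerron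
  (torusGraph_connected)

/-! ### The void radius of the line (graph distance to the nearest particle of `T`, `0` if `T = ∅`)

The stubs `stub_voidTail`, `stub_annealedGain`, `stub_transfer` use the expression
`ρ_T(x) = ((T.image fun t => (torusGraph 3 L).dist x t).min.untopD 0)` verbatim; we keep it raw. -/

/-- The void radius of the empty configuration is `0` (the `untopD` default). [folklore] -/
theorem voidRadius_empty {L : ℕ} (x : TorusSite 3 L) :
    (((∅ : Finset (TorusSite 3 L)).image fun t => (torusGraph 3 L).dist x t).min.untopD 0) = 0 := by
  rw [Finset.image_empty, Finset.min_empty, WithTop.untopD_top]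

/-- If some `t₀ ∈ T` is adjacent to `x` and `x ∉ T`, the void radius is `1`. [folklore] -/
theorem voidRadius_eq_one {L : ℕ} {T : Finset (TorusSite 3 L)} {x t₀ : TorusSite 3 L}
    (ht₀ : t₀ ∈ T) (hadj : (torusGraph 3 L).Adj x t₀) (hx : x ∉ T) :
    ((T.image fun t => (torusGraph 3 L).dist x t).min.untopD 0) = 1 := by
  have hmin : (T.image fun t => (torusGraph 3 L).dist x t).min = ((1 : ℕ) : WithTop ℕ) := by
    apply le_antisymm
    · refine Finset.min_le (Finset.mem_image.mpr ⟨t₀, ht₀, ?_⟩)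
      exact SimpleGraph.dist_eq_one_iff_adj.mpr hadj
    · refine Finset.le_min fun b hb => ?_
      obtain ⟨t, ht, rfl⟩ := Finset.mem_image.mp hb
      have hne : x ≠ t := fun h => hx (h ▸ ht)
      exact WithTop.coe_le_coe.mpr ((torusGraph_connected 3 L).pos_dist_of_ne hne)
  rw [hmin]
  rfl

/-! ### `AnnealedGain'` without the eigen-equation -/

/-- Sums of the two shell functionals on a `{0,1}`-valued field supported on two sites. [folklore] -/
theorem sum_indicator_gain {Λ : Type*} [Fintype Λ] (p : Λ → Prop) [DecidablePred p] (V : ℝ)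
    (hp : (Finset.univ.filter p).card = 2) :
    (∑ x, (if p x then (1 : ℝ) else 0) ^ 2 *
        (V * (if p x then (1 : ℝ) else 0) / ∑ y, (if p y then (1 : ℝ) else 0))) = V := by
  have hsum : (∑ y, (if p y then (1 : ℝ) else 0)) = 2 := by
    rw [Finset.sum_boole, hp]; norm_num
  rw [hsum]
  have h : ∀ x, (if p x then (1 : ℝ) else 0) ^ 2 * (V * (if p x then (1 : ℝ) else 0) / 2) =
      if p x then V / 2 else 0 := by
    intro x; split_ifs <;> ring
  simp_rw [h]
  rw [Finset.sum_ite, Finset.sum_const_zero, add_zero, Finset.sum_const, hp, nsmul_eq_mul]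
  push_cast
  ring

/-- **Any proof of `stub_annealedGain` must use the eigen-equation.** Witness: `N = 2`, the frozen
pair `δ_{1_{{a,b}}}`; `T = ∅` has void radius `0` at every site and field `1_{{a,b}}`, so the
`R = 0` shell inequality is `L³ ≤ C₂ · e⁰ · 2`, false for `L³ > 2C₂`. [folklore] -/
theorem annealedGain_false_without_groundState : ¬
    (∃ C₂ c₂ : ℝ, ∀ (L : ℕ) [NeZero L], 2 ≤ L → ∀ N : ℕ, 2 ≤ N → 2 * N ≤ L ^ 3 →
      ∀ ψ : TensorIndex (TorusSite 3 L) 2 → ℂ,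
        ψ ∈ spinZSector 1 ((N : ℝ) - (L : ℝ) ^ 3 / 2) → ψ ≠ 0 →
        (∀ σ, 0 ≤ (ψ σ).re ∧ (ψ σ).im = 0) → ∀ R : ℕ,
        (∑ T ∈ (Finset.univ : Finset (TorusSite 3 L)).powersetCard (N - 2), ∑ x : TorusSite 3 L,
            if ((T.image fun t => (torusGraph 3 L).dist x t).min.untopD 0) = R then
              field ψ T x ^ 2 * ((L : ℝ) ^ 3 * field ψ T x / ∑ y : TorusSite 3 L, field ψ T y)
            else 0)
          ≤ C₂ * Real.exp (c₂ * ((N : ℝ) / (L : ℝ) ^ 3) * (R : ℝ) ^ 2) *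
            ∑ T ∈ (Finset.univ : Finset (TorusSite 3 L)).powersetCard (N - 2), ∑ x : TorusSite 3 L,
              if ((T.image fun t => (torusGraph 3 L).dist x t).min.untopD 0) = R then
                field ψ T x ^ 2 else 0) := by
  rintro ⟨C₂, c₂, h⟩
  obtain ⟨L, hL2, hLM⟩ := exists_side_gt (2 * C₂)
  haveI : NeZero L := ⟨by omega⟩
  obtain ⟨a, b, hab⟩ := exists_pair_torusSite L hL2
  have hNL : 2 * 2 ≤ L ^ 3 :=
    calc 2 * 2 ≤ 2 ^ 3 := by norm_num
      _ ≤ L ^ 3 := Nat.pow_le_pow_left hL2 3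
  have hsec : bvec (fun z => if z ∈ ({a, b} : Finset (TorusSite 3 L)) then (0 : Fin 2) else 1) ∈
      spinZSector 1 (((2 : ℕ) : ℝ) - (L : ℝ) ^ 3 / 2) := by
    refine bvec_ind_mem_spinZSector _ _ ?_
    rw [Finset.card_pair hab, card_torusSite 3 L]
    push_cast
    ring
  have key := h L hL2 2 le_rfl hNL _ hsec (bvec_ne_zero _) (bvec_nonneg _) 0
  have hcard : (Finset.univ.filter fun x : TorusSite 3 L => x = a ∨ x = b).card = 2 := by
    have hf : (Finset.univ.filter fun x : TorusSite 3 L => x = a ∨ x = b) = {a, b} := by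
      ext x; simp
    rw [hf, Finset.card_pair hab]
  rw [show 2 - 2 = 0 from rfl, Finset.powersetCard_zero, Finset.sum_singleton,
    Finset.sum_singleton] at key
  simp only [Finset.image_empty, Finset.min_empty, WithTop.untopD_top, if_true, Nat.cast_zero,
    Nat.cast_ofNat] at key
  rw [field_pairState hab, sum_indicator_gain _ _ hcard] at key
  have hrhs : (∑ x : TorusSite 3 L, (if x = a ∨ x = b then (1 : ℝ) else 0) ^ 2) = 2 := by
    have := K1rhs_boolIndicator (Λ := TorusSite 3 L) (fun x => x = a ∨ x = b)
    rw [K1rhs] at this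
    rw [this, hcard]; norm_num
  rw [hrhs] at key
  have hexp : Real.exp (c₂ * ((2 : ℝ) / (L : ℝ) ^ 3) * (0 : ℝ) ^ 2) = 1 := by
    rw [sq, mul_zero, mul_zero, Real.exp_zero]
  rw [hexp] at key
  linarith

/-! ### `AnnealedGain'` without the filling restriction -/

/-- Two distinct neighbours `e₀, e₁` of the origin of `(ℤ/Lℤ)³`, `L ≥ 2`. [folklore] -/
theorem origin_neighbours (L : ℕ) (hL : 2 ≤ L) :
    (torusGraph 3 L).Adj (0 : TorusSite 3 L) (Pi.single 0 1) ∧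
      (Pi.single (0 : Fin 3) (1 : ZMod L) : TorusSite 3 L) ≠ Pi.single 1 1 ∧
      (Pi.single (0 : Fin 3) (1 : ZMod L) : TorusSite 3 L) ≠ 0 ∧
      (Pi.single (1 : Fin 3) (1 : ZMod L) : TorusSite 3 L) ≠ 0 := by
  haveI : Fact (1 < L) := ⟨hL⟩
  have h1 : (1 : ZMod L) ≠ 0 := one_ne_zero
  have hne0 : (Pi.single (0 : Fin 3) (1 : ZMod L) : TorusSite 3 L) ≠ 0 := by
    intro h
    have := congrFun h 0
    simp at this
  have hne1 : (Pi.single (1 : Fin 3) (1 : ZMod L) : TorusSite 3 L) ≠ 0 := by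
    intro h
    have := congrFun h 1
    simp at this
  have hne01 : (Pi.single (0 : Fin 3) (1 : ZMod L) : TorusSite 3 L) ≠ Pi.single 1 1 := by
    intro h
    have := congrFun h 0
    simp at this
  refine ⟨?_, hne01, hne0, hne1⟩
  rw [torusGraph_adj_iff]
  exact ⟨hne0.symm, Or.inl ⟨0, by rw [zero_add]⟩⟩

/-- **Any proof of `stub_annealedGain` must use `2N ≤ L³`.** Witness: `N = L³`, `ψ = |↑…↑⟩`
(`H|↑…↑⟩ = 0 = E_min` in the saturated sector); at every `(L³-2)`-set `T` the two-hole field is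
`1_{Tᶜ}`, so on the `R = 1` shell the left side is `(L³/2)·S` and the right side `C₂e^{c₂}·S` with
`S ≥ 1` the number of pairs `(T, x)`, `x ∉ T`, at void radius `1` (e.g. `T = Λ ∖ {0, e₁}`, `x = 0`,
whose neighbour `e₀` lies in `T`): `L³ ≤ 2C₂e^{c₂}` fails for large `L`. [folklore] -/
theorem annealedGain_false_without_halfFilling : ¬
    (∃ C₂ c₂ : ℝ, ∀ (L : ℕ) [NeZero L], 2 ≤ L → ∀ N : ℕ, 2 ≤ N →
      ∀ ψ : TensorIndex (TorusSite 3 L) 2 → ℂ,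
        ψ ∈ spinZSector 1 ((N : ℝ) - (L : ℝ) ^ 3 / 2) → ψ ≠ 0 →
        (xyTorus 3 L 1).mulVec ψ =
          ((lowestEnergyInSector 1 (xyTorus 3 L 1) ((N : ℝ) - (L : ℝ) ^ 3 / 2) : ℝ) : ℂ) • ψ →
        (∀ σ, 0 ≤ (ψ σ).re ∧ (ψ σ).im = 0) → ∀ R : ℕ,
        (∑ T ∈ (Finset.univ : Finset (TorusSite 3 L)).powersetCard (N - 2), ∑ x : TorusSite 3 L,
            if ((T.image fun t => (torusGraph 3 L).dist x t).min.untopD 0) = R then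
              field ψ T x ^ 2 * ((L : ℝ) ^ 3 * field ψ T x / ∑ y : TorusSite 3 L, field ψ T y)
            else 0)
          ≤ C₂ * Real.exp (c₂ * ((N : ℝ) / (L : ℝ) ^ 3) * (R : ℝ) ^ 2) *
            ∑ T ∈ (Finset.univ : Finset (TorusSite 3 L)).powersetCard (N - 2), ∑ x : TorusSite 3 L,
              if ((T.image fun t => (torusGraph 3 L).dist x t).min.untopD 0) = R then
                field ψ T x ^ 2 else 0) := by
  rintro ⟨C₂, c₂, h⟩
  obtain ⟨L, hL2, hLM⟩ := exists_side_gt (2 * C₂ * Real.exp c₂)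
  haveI : NeZero L := ⟨by omega⟩
  have hL3 : 2 ≤ L ^ 3 :=
    calc 2 ≤ 2 ^ 3 := by norm_num
      _ ≤ L ^ 3 := Nat.pow_le_pow_left hL2 3
  set σ₀ : TensorIndex (TorusSite 3 L) 2 :=
    fun z => if z ∈ (Finset.univ : Finset (TorusSite 3 L)) then (0 : Fin 2) else 1 with hσ₀
  have hσ₀' : σ₀ = fun _ => 0 := by
    funext z
    simp [hσ₀]
  have hsec : bvec σ₀ ∈ spinZSector 1 (((L ^ 3 : ℕ) : ℝ) - (L : ℝ) ^ 3 / 2) := by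
    refine bvec_ind_mem_spinZSector _ _ ?_
    rw [Finset.card_univ, card_torusSite 3 L]
    push_cast
    ring
  have hE : lowestEnergyInSector 1 (xyTorus 3 L 1) (((L ^ 3 : ℕ) : ℝ) - (L : ℝ) ^ 3 / 2) = 0 := by
    refine lowestEnergyInSector_allUp _ _ _ ?_
    rw [card_torusSite 3 L]
    push_cast
    ring
  have heig : (xyTorus 3 L 1).mulVec (bvec σ₀) =
      ((lowestEnergyInSector 1 (xyTorus 3 L 1) (((L ^ 3 : ℕ) : ℝ) - (L : ℝ) ^ 3 / 2) : ℝ) : ℂ) •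
        bvec σ₀ := by
    rw [hE, Complex.ofReal_zero, zero_smul, mulVec_bvec, hσ₀']
    funext σ
    exact xxz_apply_allUp _ _ σ
  have key := h L hL2 (L ^ 3) hL3 (bvec σ₀) hsec (bvec_ne_zero _) heig (bvec_nonneg _) 1
  -- the cardinality bookkeeping on `(L³ - 2)`-sets
  have hTcard : ∀ T ∈ (Finset.univ : Finset (TorusSite 3 L)).powersetCard (L ^ 3 - 2),
      T.card + 2 = Fintype.card (TorusSite 3 L) := by
    intro T hT
    rw [(Finset.mem_powersetCard.mp hT).2, card_torusSite 3 L]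
    omega
  -- the shell indicator, abbreviated
  set S : ℝ := ∑ T ∈ (Finset.univ : Finset (TorusSite 3 L)).powersetCard (L ^ 3 - 2),
      ∑ x : TorusSite 3 L, (if ((T.image fun t => (torusGraph 3 L).dist x t).min.untopD 0) = 1 then (if x ∉ T then (1 : ℝ) else 0) else 0)
    with hS
  -- left side = (L³/2)·S
  have hlhs : (∑ T ∈ (Finset.univ : Finset (TorusSite 3 L)).powersetCard (L ^ 3 - 2),
      ∑ x : TorusSite 3 L,
        (if ((T.image fun t => (torusGraph 3 L).dist x t).min.untopD 0) = 1 then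
          field (bvec σ₀) T x ^ 2 *
            ((L : ℝ) ^ 3 * field (bvec σ₀) T x / ∑ y : TorusSite 3 L, field (bvec σ₀) T y)
        else 0)) = (L : ℝ) ^ 3 / 2 * S := by
    rw [hS, Finset.mul_sum]
    refine Finset.sum_congr rfl fun T hT => ?_
    rw [Finset.mul_sum]
    refine Finset.sum_congr rfl fun x _ => ?_
    have hf := field_fullState T (hTcard T hT)
    rw [hσ₀, hf]
    have hsum : (∑ y : TorusSite 3 L, (if y ∉ T then (1 : ℝ) else 0)) = 2 := by
      rw [Finset.sum_boole, card_filter_notMem T (hTcard T hT)]; norm_num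
    rw [hsum]
    change (if ((T.image fun t => (torusGraph 3 L).dist x t).min.untopD 0) = 1 then _ else _) = _
    by_cases hρ : ((T.image fun t => (torusGraph 3 L).dist x t).min.untopD 0) = 1
    · by_cases hx : x ∈ T
      · simp [hρ, hx]
      · simp [hρ, hx]
    · simp [hρ]
  -- right side sum = S
  have hrhs : (∑ T ∈ (Finset.univ : Finset (TorusSite 3 L)).powersetCard (L ^ 3 - 2),
      ∑ x : TorusSite 3 L,
        (if ((T.image fun t => (torusGraph 3 L).dist x t).min.untopD 0) = 1 then
          field (bvec σ₀) T x ^ 2 else 0)) = S := by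
    rw [hS]
    refine Finset.sum_congr rfl fun T hT => Finset.sum_congr rfl fun x _ => ?_
    have hf := field_fullState T (hTcard T hT)
    rw [hσ₀, hf]
    change (if ((T.image fun t => (torusGraph 3 L).dist x t).min.untopD 0) = 1 then _ else _) = _
    by_cases hρ : ((T.image fun t => (torusGraph 3 L).dist x t).min.untopD 0) = 1
    · by_cases hx : x ∈ T
      · simp [hρ, hx]
      · simp [hρ, hx]
    · simp [hρ]
  rw [hlhs, hrhs] at key
  -- S ≥ 1: the pair (T₀, 0) with T₀ = Λ \ {0, e₁}
  obtain ⟨hadj, hne01, hne0, hne1⟩ := origin_neighbours L hL2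
  set T₀ : Finset (TorusSite 3 L) := Finset.univ \ {0, Pi.single 1 1} with hT₀
  have hT₀mem : T₀ ∈ (Finset.univ : Finset (TorusSite 3 L)).powersetCard (L ^ 3 - 2) := by
    rw [Finset.mem_powersetCard]
    refine ⟨Finset.subset_univ _, ?_⟩
    rw [hT₀, Finset.card_sdiff, Finset.inter_univ, Finset.card_univ, card_torusSite 3 L,
      Finset.card_pair hne1.symm]
  have h0T₀ : (0 : TorusSite 3 L) ∉ T₀ := by
    rw [hT₀]; simp
  have he₀T₀ : (Pi.single (0 : Fin 3) (1 : ZMod L) : TorusSite 3 L) ∈ T₀ := by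
    rw [hT₀]
    simp only [Finset.mem_sdiff, Finset.mem_univ, Finset.mem_insert, Finset.mem_singleton,
      true_and, not_or]
    exact ⟨hne0, hne01⟩
  have hρ : ((T₀.image fun t => (torusGraph 3 L).dist 0 t).min.untopD 0) = 1 := voidRadius_eq_one he₀T₀ hadj h0T₀
  have hS1 : 1 ≤ S := by
    set f : Finset (TorusSite 3 L) → TorusSite 3 L → ℝ := fun T x =>
      if ((T.image fun t => (torusGraph 3 L).dist x t).min.untopD 0) = 1 then (if x ∉ T then (1 : ℝ) else 0) else 0 with hfdef
    have hf0 : ∀ T x, 0 ≤ f T x := by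
      intro T x
      simp only [hfdef]
      split_ifs <;> norm_num
    have hterm : f T₀ 0 = 1 := by
      simp only [hfdef]
      rw [if_pos hρ, if_pos h0T₀]
    have h1 : f T₀ 0 ≤ ∑ x : TorusSite 3 L, f T₀ x :=
      Finset.single_le_sum (f := fun x => f T₀ x) (fun x _ => hf0 T₀ x) (Finset.mem_univ _)
    have h2 : (∑ x : TorusSite 3 L, f T₀ x) ≤
        ∑ T ∈ (Finset.univ : Finset (TorusSite 3 L)).powersetCard (L ^ 3 - 2),
          ∑ x : TorusSite 3 L, f T x :=
      Finset.single_le_sum (f := fun T => ∑ x : TorusSite 3 L, f T x)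
        (fun T _ => Finset.sum_nonneg fun x _ => hf0 T x) hT₀mem
    have hS' : S = ∑ T ∈ (Finset.univ : Finset (TorusSite 3 L)).powersetCard (L ^ 3 - 2),
        ∑ x : TorusSite 3 L, f T x := by rw [hS]
    rw [hS']
    linarith
  have hexp : Real.exp (c₂ * ((((L ^ 3 : ℕ) : ℝ)) / (L : ℝ) ^ 3) * ((1 : ℕ) : ℝ) ^ 2) =
      Real.exp c₂ := by
    have hL0 : (L : ℝ) ^ 3 ≠ 0 := by
      have : (0 : ℝ) < L := by exact_mod_cast (show 0 < L by omega)
      positivity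
    push_cast
    rw [div_self hL0]
    simp
  rw [hexp] at key
  -- key : L³/2 · S ≤ C₂ e^{c₂} S, with S ≥ 1 and L³ > 2 C₂ e^{c₂}
  have hpos : 0 < Real.exp c₂ := Real.exp_pos _
  have hS0 : 0 < S := by linarith
  have key' : (L : ℝ) ^ 3 / 2 ≤ C₂ * Real.exp c₂ := le_of_mul_le_mul_right (by linarith) hS0
  linarith


/-! ### A lower bound for the graph distance on the torus: the depth of the first coordinate

`depth(z) = min(z.val, L - z.val)` is the distance from `z ∈ ℤ/Lℤ` to `0` along the cycle; it is
1-Lipschitz along torus edges, whence `dist(0, t) ≥ depth(t 0)`. (Kept def-free.) -/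

/-- One step `z ↦ z + 1` changes the depth by at most one (both directions). [folklore] -/
theorem torusDepth_add_one {L : ℕ} (hL : 2 ≤ L) (z : ZMod L) :
    min (z + 1).val (L - (z + 1).val) ≤ min z.val (L - z.val) + 1 ∧
      min z.val (L - z.val) ≤ min (z + 1).val (L - (z + 1).val) + 1 := by
  haveI : NeZero L := ⟨by omega⟩
  haveI : Fact (1 < L) := ⟨hL⟩
  have hv : (z + 1).val = (z.val + 1) % L := by rw [ZMod.val_add, ZMod.val_one]
  have hz : z.val < L := ZMod.val_lt z
  by_cases h : z.val + 1 < L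
  · rw [Nat.mod_eq_of_lt h] at hv; rw [hv]; omega
  · rw [show z.val + 1 = L by omega, Nat.mod_self] at hv; rw [hv]; omega

/-- Along an edge of the torus graph the first-coordinate depth changes by at most one. [folklore] -/
theorem torusDepth_le_of_adj {L : ℕ} (hL : 2 ≤ L) {u w : TorusSite 3 L}
    (h : (torusGraph 3 L).Adj u w) :
    min (w 0).val (L - (w 0).val) ≤ min (u 0).val (L - (u 0).val) + 1 := by
  rw [torusGraph_adj_iff] at h
  obtain ⟨-, ⟨i, hi⟩ | ⟨i, hi⟩⟩ := h
  · have : w 0 = u 0 + (Pi.single i (1 : ZMod L) : TorusSite 3 L) 0 := by rw [hi]; rfl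
    by_cases hi0 : i = 0
    · subst hi0; rw [this, Pi.single_eq_same]; exact (torusDepth_add_one hL _).1
    · rw [this, Pi.single_eq_of_ne (Ne.symm hi0), add_zero]; omega
  · have : u 0 = w 0 + (Pi.single i (1 : ZMod L) : TorusSite 3 L) 0 := by rw [hi]; rfl
    by_cases hi0 : i = 0
    · subst hi0; rw [this, Pi.single_eq_same]; exact (torusDepth_add_one hL _).2
    · rw [this, Pi.single_eq_of_ne (Ne.symm hi0), add_zero]; exact Nat.le_succ _

/-- Along a walk the depth grows by at most the length. [folklore] -/
theorem torusDepth_le_add_length {L : ℕ} (hL : 2 ≤ L) :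
    ∀ {u v : TorusSite 3 L} (p : (torusGraph 3 L).Walk u v),
      min (v 0).val (L - (v 0).val) ≤ min (u 0).val (L - (u 0).val) + p.length := by
  intro u v p
  induction p with
  | nil => simp
  | cons h p ih => rw [SimpleGraph.Walk.length_cons]; have := torusDepth_le_of_adj hL h; omega

/-- **Distance lower bound on the torus**: `dist(0, t) ≥ min(t₀, L - t₀)`, the cyclic depth of the
first coordinate. [folklore] -/
theorem torusDepth_le_dist {L : ℕ} (hL : 2 ≤ L) (t : TorusSite 3 L) :
    min (t 0).val (L - (t 0).val) ≤ (torusGraph 3 L).dist 0 t := by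
  haveI : NeZero L := ⟨by omega⟩
  obtain ⟨p, hp⟩ :=
    ((torusGraph_connected 3 L).preconnected (0 : TorusSite 3 L) t).exists_walk_length_eq_dist
  have h := torusDepth_le_add_length hL p
  rw [hp] at h
  have h0 : ((0 : TorusSite 3 L) 0).val = 0 := ZMod.val_zero
  rw [h0] at h
  omega

/-! ### `VoidTail'` without the eigen-equation -/


/-- Polynomials lose against exponentials: for `c > 0` there are arbitrarily large `N` with
`C N⁵ e^{-cN/64} < N - 1`. [folklore] -/
theorem exists_large_N (C c : ℝ) (hc : 0 < c) (N₀ : ℕ) :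
    ∃ N : ℕ, N₀ ≤ N ∧ 3 ≤ N ∧ C * (N : ℝ) ^ 5 * Real.exp (-(c * N / 64)) < (N : ℝ) - 1 := by
  set A : ℝ := 720 * 64 ^ 6 * |C| / c ^ 6 with hA
  have hA0 : 0 ≤ A := by rw [hA]; positivity
  obtain ⟨N, hN⟩ := exists_nat_gt (A + N₀ + 3)
  have hN₀ : (0 : ℝ) ≤ N₀ := Nat.cast_nonneg _
  have hN3 : (3 : ℝ) ≤ N := by linarith
  refine ⟨N, by exact_mod_cast (show (N₀ : ℝ) ≤ N by linarith), by exact_mod_cast hN3, ?_⟩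
  · have hNpos : (0 : ℝ) < N := by linarith
    set y : ℝ := c * N / 64 with hy
    have hypos : 0 < y := by rw [hy]; positivity
    have hexp : Real.exp (-y) ≤ 720 / y ^ 6 := by
      have h6 := Real.pow_div_factorial_le_exp y hypos.le 6
      have hfac : ((Nat.factorial 6 : ℕ) : ℝ) = 720 := by norm_num [Nat.factorial]
      rw [hfac] at h6
      rw [Real.exp_neg, inv_eq_one_div, div_le_div_iff₀ (Real.exp_pos y) (by positivity)]
      rw [div_le_iff₀ (by norm_num : (0 : ℝ) < 720)] at h6
      linarith
    have hbound : C * (N : ℝ) ^ 5 * Real.exp (-y) ≤ A / N := by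
      calc C * (N : ℝ) ^ 5 * Real.exp (-y) ≤ |C| * (N : ℝ) ^ 5 * Real.exp (-y) := by
            have : C ≤ |C| := le_abs_self C
            have h0 : 0 ≤ (N : ℝ) ^ 5 * Real.exp (-y) := by positivity
            nlinarith
        _ ≤ |C| * (N : ℝ) ^ 5 * (720 / y ^ 6) := by
            have h0 : 0 ≤ |C| * (N : ℝ) ^ 5 := by positivity
            exact mul_le_mul_of_nonneg_left hexp h0
        _ = A / N := by rw [hA, hy]; field_simp
    have hAN : A / N < (N : ℝ) - 1 := by rw [div_lt_iff₀ hNpos]; nlinarith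
    linarith

/-- **Any proof of `stub_voidTail` must use the eigen-equation.** Witness (given `C₁`, `c₁ > 0`):
`L = 4N`, `R = N`, `ψ = δ_{1_S}` with `S = {0} ∪ K`, `K` = `N - 1` sites of the far slab
`{k : k₀ = 2N}` (all at graph distance `≥ 2N > R` from `0`, `torusDepth_le_dist`). For `T = K ∖ {k}`
and `x = 0` the void radius exceeds `R` and `r^T_0 ≥ 1`, so the left side is `≥ N - 1`, while the
total weight is `≤ N⁵` and the allowance `C₁ e^{-c₁ (N/L³) R³} N⁵ = C₁ N⁵ e^{-c₁N/64} < N - 1` for `N`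
large (`exists_large_N`). [folklore] -/
theorem voidTail_false_without_groundState : ¬
    (∃ C₁ c₁ : ℝ, 0 < c₁ ∧ ∀ (L : ℕ) [NeZero L], 2 ≤ L → ∀ N : ℕ, 2 ≤ N → 2 * N ≤ L ^ 3 →
      ∀ ψ : TensorIndex (TorusSite 3 L) 2 → ℂ,
        ψ ∈ spinZSector 1 ((N : ℝ) - (L : ℝ) ^ 3 / 2) → ψ ≠ 0 →
        (∀ σ, 0 ≤ (ψ σ).re ∧ (ψ σ).im = 0) → ∀ R : ℕ,
        (∑ T ∈ (Finset.univ : Finset (TorusSite 3 L)).powersetCard (N - 2), ∑ x : TorusSite 3 L,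
            if R < ((T.image fun t => (torusGraph 3 L).dist x t).min.untopD 0) then
              field ψ T x ^ 2 else 0)
          ≤ C₁ * Real.exp (-(c₁ * ((N : ℝ) / (L : ℝ) ^ 3) * (R : ℝ) ^ 3)) *
            ∑ T ∈ (Finset.univ : Finset (TorusSite 3 L)).powersetCard (N - 2), ∑ x : TorusSite 3 L,
              field ψ T x ^ 2) := by
  rintro ⟨C₁, c₁, hc₁, h⟩
  obtain ⟨N, -, hN3, hNbig⟩ := exists_large_N C₁ c₁ hc₁ 0
  set L : ℕ := 4 * N with hLdef
  have hL2 : 2 ≤ L := by omega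
  haveI : NeZero L := ⟨by omega⟩
  have hN2 : 2 ≤ N := by omega
  have hNL : 2 * N ≤ L ^ 3 := by
    rw [hLdef]
    calc 2 * N ≤ 4 * N := by omega
      _ ≤ (4 * N) ^ 3 := Nat.le_self_pow (by norm_num) _
  -- the far coordinate value c = 2N (depth 2N)
  set c : ZMod L := ((2 * N : ℕ) : ZMod L) with hcdef
  have hcval : c.val = 2 * N := by rw [hcdef, ZMod.val_cast_of_lt (by omega)]
  have hcdepth : min c.val (L - c.val) = 2 * N := by rw [hcval]; omega
  have hc0 : c ≠ 0 := by
    intro h0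
    have := congrArg ZMod.val h0
    rw [hcval, ZMod.val_zero] at this
    omega
  -- the slab points k_j = (c, j, 0), j < N - 1
  set kpt : ℕ → TorusSite 3 L := fun j => ![c, ((j : ℕ) : ZMod L), 0] with hkpt
  have hkpt0 : ∀ j, kpt j 0 = c := fun j => by simp [hkpt]
  have hkpt1 : ∀ j, kpt j 1 = ((j : ℕ) : ZMod L) := fun j => by simp [hkpt]
  have hinj : Set.InjOn kpt (Finset.range (N - 1) : Finset ℕ) := by
    intro j₁ hj₁ j₂ hj₂ hj
    have h1 := congrFun hj 1
    rw [hkpt1, hkpt1] at h1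
    have hj₁L : j₁ < L := by
      have := Finset.mem_range.mp hj₁; omega
    have hj₂L : j₂ < L := by
      have := Finset.mem_range.mp hj₂; omega
    have := congrArg ZMod.val h1
    rwa [ZMod.val_cast_of_lt hj₁L, ZMod.val_cast_of_lt hj₂L] at this
  set K : Finset (TorusSite 3 L) := (Finset.range (N - 1)).image kpt with hKdef
  have hKcard : K.card = N - 1 := by
    rw [hKdef, Finset.card_image_of_injOn hinj, Finset.card_range]
  have hK0 : ∀ k ∈ K, k 0 = c := by
    intro k hk
    obtain ⟨j, -, rfl⟩ := Finset.mem_image.mp hk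
    exact hkpt0 j
  have h0K : (0 : TorusSite 3 L) ∉ K := by
    intro h0
    have := hK0 0 h0
    exact hc0 (by rw [← this]; rfl)
  set S : Finset (TorusSite 3 L) := insert 0 K with hSdef
  have hScard : S.card = N := by
    rw [hSdef, Finset.card_insert_of_notMem h0K, hKcard]; omega
  -- the witness vector
  set ψ : TensorIndex (TorusSite 3 L) 2 → ℂ :=
    bvec (fun z => if z ∈ S then (0 : Fin 2) else 1) with hψdef
  have hsec : ψ ∈ spinZSector 1 ((N : ℝ) - (L : ℝ) ^ 3 / 2) := by
    refine bvec_ind_mem_spinZSector _ _ ?_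
    rw [hScard, card_torusSite 3 L]
    push_cast
    ring
  have hnn : ∀ σ, 0 ≤ (ψ σ).re ∧ (ψ σ).im = 0 := bvec_nonneg _
  have hnn' : ∀ σ, 0 ≤ (ψ σ).re := fun σ => (hnn σ).1
  have key := h L hL2 N hN2 hNL ψ hsec (bvec_ne_zero _) hnn N
  set PC := (Finset.univ : Finset (TorusSite 3 L)).powersetCard (N - 2) with hPC
  set g : Finset (TorusSite 3 L) → TorusSite 3 L → ℝ := fun T x =>
    if N < ((T.image fun t => (torusGraph 3 L).dist x t).min.untopD 0) then field ψ T x ^ 2 else 0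
    with hgdef
  have hg0 : ∀ T x, 0 ≤ g T x := by
    intro T x
    simp only [hgdef]
    split_ifs
    · positivity
    · exact le_rfl
  have hTmem : ∀ k ∈ K, K.erase k ∈ PC := by
    intro k hk
    rw [hPC, Finset.mem_powersetCard]
    refine ⟨Finset.subset_univ _, ?_⟩
    rw [Finset.card_erase_of_mem hk, hKcard]
    omega
  have herase_inj : Set.InjOn (fun k => K.erase k) (K : Set (TorusSite 3 L)) := by
    intro k₁ hk₁ k₂ hk₂ hk
    by_contra hne
    have : k₂ ∈ K.erase k₁ := Finset.mem_erase.mpr ⟨Ne.symm hne, hk₂⟩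
    rw [show (fun k => K.erase k) k₁ = K.erase k₁ from rfl,
      show (fun k => K.erase k) k₂ = K.erase k₂ from rfl] at hk
    rw [hk] at this
    exact (Finset.notMem_erase k₂ K) this
  -- void radius of (K \ {k}, 0) exceeds N
  have hvoid : ∀ k ∈ K, N < (((K.erase k).image fun t => (torusGraph 3 L).dist 0 t).min.untopD 0) := by
    intro k hk
    have hne : (K.erase k).Nonempty := by
      rw [← Finset.card_pos, Finset.card_erase_of_mem hk, hKcard]; omega
    obtain ⟨t₀, ht₀⟩ := hne
    obtain ⟨b, hb⟩ := Finset.min_of_mem (Finset.mem_image_of_mem (fun t => (torusGraph 3 L).dist 0 t) ht₀)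
    rw [hb]
    change N < b
    obtain ⟨t, ht, htb⟩ := Finset.mem_image.mp (Finset.mem_of_min hb)
    rw [← htb]
    have htK : t ∈ K := Finset.mem_of_mem_erase ht
    have hdepth := torusDepth_le_dist hL2 t
    rw [hK0 t htK, hcdepth] at hdepth
    omega
  -- the field at (K \ {k}, 0) is ≥ 1
  have hfield : ∀ k ∈ K, 1 ≤ field ψ (K.erase k) 0 := by
    intro k hk
    have h0T : (0 : TorusSite 3 L) ∉ K.erase k := fun h0 => h0K (Finset.mem_of_mem_erase h0)
    have hkT : k ∉ K.erase k := Finset.notMem_erase k K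
    have h0k : (0 : TorusSite 3 L) ≠ k := fun h0 => h0K (h0 ▸ hk)
    have hle := le_field ψ hnn' (K.erase k) h0T hkT h0k
    have hS' : insert 0 (insert k (K.erase k)) = S := by
      rw [Finset.insert_erase hk]
    rw [hS', hψdef, bvec_ind_re, if_pos rfl] at hle
    exact hle
  have hlhs : ((N : ℝ) - 1) ≤ ∑ T ∈ PC, ∑ x : TorusSite 3 L, g T x := by
    have h1 : ∑ T ∈ K.image (fun k => K.erase k), ∑ x : TorusSite 3 L, g T x ≤
        ∑ T ∈ PC, ∑ x : TorusSite 3 L, g T x := by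
      apply Finset.sum_le_sum_of_subset_of_nonneg
      · intro T hT
        obtain ⟨k, hk, rfl⟩ := Finset.mem_image.mp hT
        exact hTmem k hk
      · intro T _ _
        exact Finset.sum_nonneg fun x _ => hg0 T x
    have h2 : ∑ T ∈ K.image (fun k => K.erase k), ∑ x : TorusSite 3 L, g T x =
        ∑ k ∈ K, ∑ x : TorusSite 3 L, g (K.erase k) x := Finset.sum_image herase_inj
    have h3 : ∀ k ∈ K, (1 : ℝ) ≤ ∑ x : TorusSite 3 L, g (K.erase k) x := by
      intro k hk
      have hgk : 1 ≤ g (K.erase k) 0 := by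
        simp only [hgdef]
        rw [if_pos (hvoid k hk)]
        have := hfield k hk
        nlinarith
      exact hgk.trans (Finset.single_le_sum (f := fun x => g (K.erase k) x) (fun x _ => hg0 _ x)
        (Finset.mem_univ _))
    have h4 : ((N : ℝ) - 1) ≤ ∑ k ∈ K, ∑ x : TorusSite 3 L, g (K.erase k) x := by
      have := Finset.card_nsmul_le_sum K (fun k => ∑ x : TorusSite 3 L, g (K.erase k) x) 1 h3
      rw [hKcard, nsmul_eq_mul, mul_one] at this
      have hcast : (((N - 1 : ℕ)) : ℝ) = (N : ℝ) - 1 := by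
        rw [Nat.cast_sub (by omega)]; simp
      rw [hcast] at this
      exact this
    linarith
  have hterm : ∀ (T : Finset (TorusSite 3 L)) (x y : TorusSite 3 L),
      (if x ∉ T ∧ y ∉ T ∧ x ≠ y then
          (ψ (fun z => if z ∈ insert x (insert y T) then 0 else 1)).re else 0) ≤
        (if x ∈ S ∧ T ⊆ S then (1 : ℝ) else 0) * (if y ∈ S then (1 : ℝ) else 0) := by
    intro T x y
    by_cases hc : x ∉ T ∧ y ∉ T ∧ x ≠ y
    · rw [if_pos hc, hψdef, bvec_ind_re]
      by_cases hS' : insert x (insert y T) = S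
      · have hx : x ∈ S := hS' ▸ Finset.mem_insert_self x _
        have hy : y ∈ S := hS' ▸ Finset.mem_insert_of_mem (Finset.mem_insert_self y T)
        have hT : T ⊆ S := fun t ht =>
          hS' ▸ Finset.mem_insert_of_mem (Finset.mem_insert_of_mem ht)
        rw [if_pos hS', if_pos ⟨hx, hT⟩, if_pos hy]; norm_num
      · rw [if_neg hS']
        split_ifs <;> norm_num
    · rw [if_neg hc]
      split_ifs <;> norm_num
  have hfield_le : ∀ (T : Finset (TorusSite 3 L)) (x : TorusSite 3 L),
      field ψ T x ≤ (if x ∈ S ∧ T ⊆ S then (1 : ℝ) else 0) * N := by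
    intro T x
    rw [field]
    calc (∑ y, if x ∉ T ∧ y ∉ T ∧ x ≠ y then
            (ψ (fun z => if z ∈ insert x (insert y T) then 0 else 1)).re else 0)
        ≤ ∑ y, (if x ∈ S ∧ T ⊆ S then (1 : ℝ) else 0) * (if y ∈ S then (1 : ℝ) else 0) :=
          Finset.sum_le_sum fun y _ => hterm T x y
      _ = (if x ∈ S ∧ T ⊆ S then (1 : ℝ) else 0) * N := by
          rw [← Finset.mul_sum, Finset.sum_boole]
          congr 1
          have : (Finset.univ.filter fun y : TorusSite 3 L => y ∈ S) = S := by ext y; simp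
          rw [this, hScard]
  have hsq_le : ∀ (T : Finset (TorusSite 3 L)) (x : TorusSite 3 L),
      field ψ T x ^ 2 ≤ (if x ∈ S ∧ T ⊆ S then (1 : ℝ) else 0) * (N : ℝ) ^ 2 := by
    intro T x
    have h0 := field_nonneg ψ hnn' T x
    have h1 := hfield_le T x
    calc field ψ T x ^ 2 ≤ ((if x ∈ S ∧ T ⊆ S then (1 : ℝ) else 0) * N) ^ 2 :=
          pow_le_pow_left₀ h0 h1 2
      _ = (if x ∈ S ∧ T ⊆ S then (1 : ℝ) else 0) * (N : ℝ) ^ 2 := by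
          split_ifs <;> ring
  have hPCfilter : PC.filter (fun T => T ⊆ S) = S.powersetCard (N - 2) := by
    ext T
    rw [hPC, Finset.mem_filter, Finset.mem_powersetCard, Finset.mem_powersetCard]
    constructor
    · rintro ⟨⟨-, hc⟩, hs⟩; exact ⟨hs, hc⟩
    · rintro ⟨hs, hc⟩; exact ⟨⟨Finset.subset_univ _, hc⟩, hs⟩
  have hchoose : ((S.powersetCard (N - 2)).card : ℝ) ≤ (N : ℝ) ^ 2 := by
    rw [Finset.card_powersetCard, hScard, Nat.choose_symm hN2]
    exact_mod_cast Nat.choose_le_pow N 2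
  have htotal : ∑ T ∈ PC, ∑ x : TorusSite 3 L, field ψ T x ^ 2 ≤ (N : ℝ) ^ 5 := by
    calc ∑ T ∈ PC, ∑ x : TorusSite 3 L, field ψ T x ^ 2
        ≤ ∑ T ∈ PC, ∑ x : TorusSite 3 L, (if x ∈ S ∧ T ⊆ S then (1 : ℝ) else 0) * (N : ℝ) ^ 2 :=
          Finset.sum_le_sum fun T _ => Finset.sum_le_sum fun x _ => hsq_le T x
      _ = ∑ T ∈ PC, (if T ⊆ S then (1 : ℝ) else 0) * ((N : ℝ) * (N : ℝ) ^ 2) := by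
          refine Finset.sum_congr rfl fun T _ => ?_
          by_cases hT : T ⊆ S
          · rw [if_pos hT, one_mul]
            have : ∀ x : TorusSite 3 L, (if x ∈ S ∧ T ⊆ S then (1 : ℝ) else 0) * (N : ℝ) ^ 2 =
                (if x ∈ S then (1 : ℝ) else 0) * (N : ℝ) ^ 2 := by
              intro x
              by_cases hx : x ∈ S
              · rw [if_pos ⟨hx, hT⟩, if_pos hx]
              · rw [if_neg (fun h => hx h.1), if_neg hx]
            simp_rw [this]
            rw [← Finset.sum_mul, Finset.sum_boole]
            have hf : (Finset.univ.filter fun y : TorusSite 3 L => y ∈ S) = S := by ext y; simp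
            rw [hf, hScard]
          · rw [if_neg hT, zero_mul]
            refine Finset.sum_eq_zero fun x _ => ?_
            rw [if_neg (fun h => hT h.2), zero_mul]
      _ = ((PC.filter fun T => T ⊆ S).card : ℝ) * ((N : ℝ) * (N : ℝ) ^ 2) := by
          rw [← Finset.sum_mul, Finset.sum_boole]
      _ ≤ (N : ℝ) ^ 2 * ((N : ℝ) * (N : ℝ) ^ 2) := by
          rw [hPCfilter]
          exact mul_le_mul_of_nonneg_right hchoose (by positivity)
      _ = (N : ℝ) ^ 5 := by ring
  have htotal0 : 0 ≤ ∑ T ∈ PC, ∑ x : TorusSite 3 L, field ψ T x ^ 2 :=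
    Finset.sum_nonneg fun T _ => Finset.sum_nonneg fun x _ => by positivity
  have hexp : Real.exp (-(c₁ * ((N : ℝ) / (L : ℝ) ^ 3) * ((N : ℕ) : ℝ) ^ 3)) =
      Real.exp (-(c₁ * N / 64)) := by
    congr 1
    rw [hLdef]
    have hN0 : (N : ℝ) ≠ 0 := by
      have : (0 : ℝ) < N := by exact_mod_cast (show 0 < N by omega)
      exact this.ne'
    push_cast
    field_simp
    ring
  change ∑ T ∈ PC, ∑ x : TorusSite 3 L, g T x ≤
    C₁ * Real.exp (-(c₁ * ((N : ℝ) / (L : ℝ) ^ 3) * ((N : ℕ) : ℝ) ^ 3)) *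
      ∑ T ∈ PC, ∑ x : TorusSite 3 L, field ψ T x ^ 2 at key
  rw [hexp] at key
  have hE : 0 < Real.exp (-(c₁ * N / 64)) := Real.exp_pos _
  by_cases hC : C₁ ≤ 0
  · have : C₁ * Real.exp (-(c₁ * N / 64)) * ∑ T ∈ PC, ∑ x : TorusSite 3 L, field ψ T x ^ 2 ≤ 0 := by
      have h1 : C₁ * Real.exp (-(c₁ * N / 64)) ≤ 0 := mul_nonpos_of_nonpos_of_nonneg hC hE.le
      exact mul_nonpos_of_nonpos_of_nonneg h1 htotal0
    have hN3' : (3 : ℝ) ≤ N := by exact_mod_cast hN3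
    linarith
  · rw [not_le] at hC
    have h1 : C₁ * Real.exp (-(c₁ * N / 64)) * ∑ T ∈ PC, ∑ x : TorusSite 3 L, field ψ T x ^ 2 ≤
        C₁ * Real.exp (-(c₁ * N / 64)) * (N : ℝ) ^ 5 :=
      mul_le_mul_of_nonneg_left htotal (by positivity)
    have h2 : C₁ * Real.exp (-(c₁ * N / 64)) * (N : ℝ) ^ 5 =
        C₁ * (N : ℝ) ^ 5 * Real.exp (-(c₁ * N / 64)) := by ring
    linarith

end Summit.AtomisticToContinuum.BoseEinsteinCondensation.Cruxes.InsertionFieldDelocalisation.DrefuteMobileTrap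

end
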